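import Literature.Algebra.EuclideanLattices.MRGapCVPRunD
import Literature.Algebra.EuclideanLattices.MRGapCVPWitnessLaw
import HarnessLib

/-!
# The conditional witness law of `W` on the dual-grid model: transfer of per-condition bounds — proved

Topic `Algebra/EuclideanLattices` (family `pqc`). Twin of `MRGapCVPWitnessLaw.lean` for the dual-grid model
of `DualGridAttemptSuccess` / `MRGapCVPRunD` (the bit-level model the machine of MR07 Thm. 5.23 runs).
Micciancio–Regev 2007, proof of Thm. 5.23 (authors' version p. 30): the per-witness bounds (16)–(18)
"hold conditioned on any fixed values of `C, A, z`" and are then read for the law `D` of a successful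
output of `W`. This file proves that TRANSFER for `wRunD` with an arbitrary oracle kernel:

* `firstStageD`, `experimentD_zero_eq_pairing` — the law `P₁` of `((c, κ), (A, z))` and the zero-shift
  experiment as `P₁ ⋉ condLawD`;
* `tsum_wRunD_some_toReal_mul` — Fubini: `∑_w Pr[wRunD = w] f(w) = ∑_{cr} P₁(cr) ∑_y condLawD(y) [SIS′] f(out)`;
* `one_sub_wRunD_none`, `one_sub_wRunD_none_toReal` — `1 − Pr[abort] = P₁[SIS′ answer]`;
* `tsum_wRunD_some_toReal_mul_le`, `tsum_condD_toReal_mul_le` — per-condition bounds `E[f(out) | c, κ, z] ≤ B`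
  (bounded real `f`) give `E_D[f] ≤ B` for the conditional witness law `D`;
* `tsum_wRunD_some_mul_le`, `tsum_condD_mul_le` — the same in `ℝ≥0∞` for nonnegative `g`.

## References

* D. Micciancio, O. Regev, *Worst-case to average-case reductions based on Gaussian measures*,
  SIAM J. Comput. 37 (2007) 267–302; authors' version, Thm. 5.23 and its proof, p. 30.
-/

noncomputable section

open scoped Classical ENNReal Real

namespace Literature.Algebra.EuclideanLattices

open Module Submodule Matrix GSInverse Finset Literature.Probability.Distributions PMF MeasureTheory
  Literature.Computability.Cryptography Literature.Computability.Cryptography.SIS MicciancioRegev2007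

namespace DualGrid

variable {n : ℕ} (B : Matrix (Fin n) (Fin n) ℤ) (N : ℕ) (S : Fin n → Fin n → ℤ) [NeZero N] {m : ℕ}

/-! ### The first stage and the pairing form of the zero-shift experiment -/

/-- **The law of the first stage `((c, κ), (A, z))` of a run of `W`** in the dual-grid model: classes and
coin boxes, then the (deterministic) query and the oracle's answer.
[cite: MicciancioRegev2007, Thm. 5.23 (proof, p. 30: "conditioning on C, A, z")] -/
def firstStageD (hB : B.det ≠ 0) {q : ℕ} (O : Matrix (Fin n) (Fin m) (ZMod q) → PMF (Fin m → ℤ)) (s : ℝ) (ℓ : ℕ) :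
    PMF (((Fin m → Grp B N) × (Fin m → Fin n → ℤ)) × (Matrix (Fin n) (Fin m) (ZMod q) × (Fin m → ℤ))) :=
  ((indepLaw m fun _ => offsetLawD B N hB s 0).bind fun c =>
      (indepLaw m fun _ => boxLaw n ℓ).map (Prod.mk c)).bind
    fun ch => ((PMF.pure (queryMatrixD B N S q ch.1 ch.2)).bind fun A => (O A).map (Prod.mk A)).map (Prod.mk ch)

/-- **The zero-shift experiment is the pairing of its first stage with `condLawD`.**
[cite: MicciancioRegev2007, Thm. 5.23 (proof, p. 30)] -/
theorem experimentD_zero_eq_pairing (hB : B.det ≠ 0) {q : ℕ} (O : Matrix (Fin n) (Fin m) (ZMod q) → PMF (Fin m → ℤ))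
    (s : ℝ) (ℓ : ℕ) :
    experimentD B N S hB O s (fun _ => 0) ℓ =
      (firstStageD B N S hB O s ℓ).bind fun cr => (condLawD B N s (fun _ => 0) cr.1.1).map (Prod.mk cr) := by
  rw [experimentD, firstStageD]
  exact PMF.bind_bind_map_comm _ _ _

/-- On the support of the first stage the matrix is the true query. [folklore] -/
theorem queryD_eq_of_mem_support_firstStageD (hB : B.det ≠ 0) {q : ℕ}
    (O : Matrix (Fin n) (Fin m) (ZMod q) → PMF (Fin m → ℤ)) (s : ℝ) (ℓ : ℕ) {cr}
    (hcr : cr ∈ (firstStageD B N S hB O s ℓ).support) : cr.2.1 = queryMatrixD B N S q cr.1.1 cr.1.2 := by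
  simp only [firstStageD, PMF.mem_support_bind_iff, PMF.support_map, Set.mem_image, PMF.support_pure,
    Set.mem_singleton_iff] at hcr
  obtain ⟨ch, -, az, ⟨A, rfl, z, -, rfl⟩, rfl⟩ := hcr
  rfl

/-! ### Fubini for the success part of `wRunD` (real, bounded) -/

/-- **The success part of `wRunD` as an iterated sum over the first stage and `condLawD`**: for bounded `f`,
`∑_w Pr[wRunD = w] f(w) = ∑_{cr} P₁(cr) ∑_y condLawD(y) [success] f(output)`.
[cite: MicciancioRegev2007, Thm. 5.23 (proof, p. 30)] -/
theorem tsum_wRunD_some_toReal_mul (hB : B.det ≠ 0) {q : ℕ} (O : Matrix (Fin n) (Fin m) (ZMod q) → PMF (Fin m → ℤ))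
    (s β : ℝ) (ℓ : ℕ) (f : EuclideanSpace ℝ (Fin n) → ℝ) {M : ℝ} (hM : 0 ≤ M) (hf : ∀ v, |f v| ≤ M) :
    ∑' w, ((wRunD B N S hB O s β ℓ) (some w)).toReal * f (w : EuclideanSpace ℝ (Fin n)) =
      ∑' cr, ((firstStageD B N S hB O s ℓ) cr).toReal *
        ∑' y, ((condLawD B N s (fun _ => 0) cr.1.1) y).toReal *
          (if IsSolution' cr.2.1 β cr.2.2 ∧ outputD B N S q (cr, y) ∈ WLat B
            then f (outputD B N S q (cr, y)) else 0) := by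
  have hG : ∀ o : Option (WLat B), |o.elim 0 (fun w : WLat B => f (w : EuclideanSpace ℝ (Fin n)))| ≤ M := by
    rintro (_ | w)
    · simpa using hM
    · exact hf _
  have hGF : ∀ ω : (((Fin m → Grp B N) × (Fin m → Fin n → ℤ)) × (Matrix (Fin n) (Fin m) (ZMod q) × (Fin m → ℤ))) ×
      (Fin m → dualLat B),
      |(if h : IsSolution' ω.1.2.1 β ω.1.2.2 ∧ outputD B N S q ω ∈ WLat B then some (⟨_, h.2⟩ : WLat B)
        else none).elim 0 (fun w : WLat B => f (w : EuclideanSpace ℝ (Fin n)))| ≤ M := fun ω => hG _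
  have h1 : ∑' w, ((wRunD B N S hB O s β ℓ) (some w)).toReal * f (w : EuclideanSpace ℝ (Fin n)) =
      ∑' o, ((wRunD B N S hB O s β ℓ) o).toReal * o.elim 0 (fun w : WLat B => f (w : EuclideanSpace ℝ (Fin n))) :=
    tsum_some_eq_tsum (fun o => ((wRunD B N S hB O s β ℓ) o).toReal *
      o.elim 0 (fun w : WLat B => f (w : EuclideanSpace ℝ (Fin n)))) (by simp)
  rw [h1, wRunD, tsum_toReal_map_mul _ _ hG, experimentD_zero_eq_pairing B N S hB O s ℓ, tsum_toReal_bind_mul _ _ hGF]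
  refine tsum_congr fun cr => ?_
  congr 1
  rw [tsum_toReal_map_mul _ _ hGF]
  refine tsum_congr fun y => ?_
  congr 1
  split_ifs <;> rfl

/-! ### The non-abort probability through the first stage -/

/-- **`1 − Pr[abort] = P₁[SIS′ answer]`** (in `ℝ≥0∞`). [cite: MicciancioRegev2007, Thm. 5.23 (proof, p. 30)] -/
theorem one_sub_wRunD_none [IsZLattice ℝ (dualLat B)] (hB : B.det ≠ 0)
    (hS : ∀ j, intVecToEuclidean n (S j) ∈ dualLat B) {q : ℕ}
    (O : Matrix (Fin n) (Fin m) (ZMod q) → PMF (Fin m → ℤ)) (s β : ℝ) (ℓ : ℕ) :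
    1 - (wRunD B N S hB O s β ℓ) none =
      (firstStageD B N S hB O s ℓ).toOuterMeasure {cr | IsSolution' cr.2.1 β cr.2.2} := by
  set E := experimentD B N S hB O s (fun _ => (0 : Fin n → ℤ)) ℓ with hE
  have hnone : (wRunD B N S hB O s β ℓ) none =
      E.toOuterMeasure {ω | IsSolution' ω.1.2.1 β ω.1.2.2 ∧ outputD B N S q ω ∈ WLat B}ᶜ := by
    rw [← PMF.toOuterMeasure_apply_singleton, wRunD, PMF.toOuterMeasure_map_apply]
    congr 1
    ext ω
    simp only [Set.mem_preimage, Set.mem_singleton_iff, Set.mem_compl_iff, Set.mem_setOf_eq]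
    split_ifs with h <;> simp [h]
  have hadd : E.toOuterMeasure {ω | IsSolution' ω.1.2.1 β ω.1.2.2 ∧ outputD B N S q ω ∈ WLat B} +
      E.toOuterMeasure {ω | IsSolution' ω.1.2.1 β ω.1.2.2 ∧ outputD B N S q ω ∈ WLat B}ᶜ = 1 := by
    rw [PMF.toOuterMeasure_apply, PMF.toOuterMeasure_apply, ← ENNReal.tsum_add, ← E.tsum_coe]
    exact tsum_congr fun x => Set.indicator_self_add_compl_apply _ _ _
  have hsub1 : 1 - (wRunD B N S hB O s β ℓ) none =
      E.toOuterMeasure {ω | IsSolution' ω.1.2.1 β ω.1.2.2 ∧ outputD B N S q ω ∈ WLat B} := by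
    rw [hnone]
    exact ENNReal.sub_eq_of_eq_add (PMF.toOuterMeasure_ne_top E _) hadd.symm
  have heq : E.toOuterMeasure {ω | IsSolution' ω.1.2.1 β ω.1.2.2 ∧ outputD B N S q ω ∈ WLat B} =
      E.toOuterMeasure {ω | IsSolution' ω.1.2.1 β ω.1.2.2} :=
    le_antisymm (E.toOuterMeasure_mono fun ω hω => hω.1.1)
      (E.toOuterMeasure_mono (Set.inter_subset_left.trans fun ω hω => ⟨hω, mem_WLat_of_mem (outputD_mem hS q ω)⟩))
  rw [hsub1, heq, hE, experimentD_zero_eq_pairing B N S hB O s ℓ,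
    show {ω : (((Fin m → Grp B N) × (Fin m → Fin n → ℤ)) × (Matrix (Fin n) (Fin m) (ZMod q) × (Fin m → ℤ))) ×
        (Fin m → dualLat B) | IsSolution' ω.1.2.1 β ω.1.2.2} = Prod.fst ⁻¹' {cr | IsSolution' cr.2.1 β cr.2.2} from rfl,
    ← PMF.toOuterMeasure_map_apply, map_fst_pairing]

/-- Real form: `1 − Pr[abort] = P₁[SIS′ answer]`. [folklore] -/
theorem one_sub_wRunD_none_toReal [IsZLattice ℝ (dualLat B)] (hB : B.det ≠ 0)
    (hS : ∀ j, intVecToEuclidean n (S j) ∈ dualLat B) {q : ℕ}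
    (O : Matrix (Fin n) (Fin m) (ZMod q) → PMF (Fin m → ℤ)) (s β : ℝ) (ℓ : ℕ) :
    1 - ((wRunD B N S hB O s β ℓ) none).toReal =
      ((firstStageD B N S hB O s ℓ).toOuterMeasure {cr | IsSolution' cr.2.1 β cr.2.2}).toReal := by
  rw [← one_sub_wRunD_none B N S hB hS, ENNReal.toReal_sub_of_le ((wRunD B N S hB O s β ℓ).coe_le_one _)
    ENNReal.one_ne_top, ENNReal.toReal_one]

/-! ### Transfer of per-condition bounds (real, bounded) -/

/-- **Per-condition bounds transfer to the success part of `wRunD`**: if for every first-stage value in the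
support whose answer is an `SIS′` solution the conditional expectation of `f(output)` over `y ∼ condLawD` is
at most `B' ≥ 0` (`f` bounded), then `∑_w Pr[wRunD = w] f(w) ≤ B' · P₁[SIS′ answer]`.
[cite: MicciancioRegev2007, Thm. 5.23 (proof, p. 30: bounds "conditioned on C, A, z" pass to w)] -/
theorem tsum_wRunD_some_toReal_mul_le [IsZLattice ℝ (dualLat B)] (hB : B.det ≠ 0)
    (hS : ∀ j, intVecToEuclidean n (S j) ∈ dualLat B) {q : ℕ}
    (O : Matrix (Fin n) (Fin m) (ZMod q) → PMF (Fin m → ℤ)) (s β : ℝ) (ℓ : ℕ)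
    (f : EuclideanSpace ℝ (Fin n) → ℝ) {M : ℝ} (hM : 0 ≤ M) (hf : ∀ v, |f v| ≤ M) {B' : ℝ} (hB' : 0 ≤ B')
    (hcond : ∀ (c : Fin m → Grp B N) (κ : Fin m → Fin n → ℤ) (z : Fin m → ℤ),
      ((c, κ), (queryMatrixD B N S q c κ, z)) ∈ (firstStageD B N S hB O s ℓ).support →
      IsSolution' (queryMatrixD B N S q c κ) β z →
      ∑' y, ((condLawD B N s (fun _ => 0) c) y).toReal *
        f (outputD B N S q (((c, κ), (queryMatrixD B N S q c κ, z)), y)) ≤ B') :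
    ∑' w, ((wRunD B N S hB O s β ℓ) (some w)).toReal * f (w : EuclideanSpace ℝ (Fin n)) ≤
      B' * ((firstStageD B N S hB O s ℓ).toOuterMeasure {cr | IsSolution' cr.2.1 β cr.2.2}).toReal := by
  set P₁ := firstStageD B N S hB O s ℓ with hP₁
  rw [tsum_wRunD_some_toReal_mul B N S hB O s β ℓ f hM hf]
  set inner : (((Fin m → Grp B N) × (Fin m → Fin n → ℤ)) × (Matrix (Fin n) (Fin m) (ZMod q) × (Fin m → ℤ))) → ℝ :=
    fun cr => ∑' y, ((condLawD B N s (fun _ => 0) cr.1.1) y).toReal *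
      (if IsSolution' cr.2.1 β cr.2.2 ∧ outputD B N S q (cr, y) ∈ WLat B then f (outputD B N S q (cr, y)) else 0)
    with hinner
  have hib : ∀ cr, |inner cr| ≤ M := fun cr =>
    abs_tsum_toReal_mul_le _ fun y => by
      split_ifs
      · exact hf _
      · simpa using hM
  have hpt : ∀ cr, (P₁ cr).toReal * inner cr ≤
      B' * {cr | IsSolution' cr.2.1 β cr.2.2}.indicator (fun cr => (P₁ cr).toReal) cr := by
    intro cr
    by_cases hcr : cr ∈ P₁.support
    · obtain ⟨⟨c, κ⟩, ⟨A, z⟩⟩ := cr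
      have hA : A = queryMatrixD B N S q c κ := queryD_eq_of_mem_support_firstStageD B N S hB O s ℓ hcr
      subst hA
      by_cases hsol : IsSolution' (queryMatrixD B N S q c κ) β z
      · rw [Set.indicator_of_mem (show ((c, κ), (queryMatrixD B N S q c κ, z)) ∈
          {cr : ((Fin m → Grp B N) × (Fin m → Fin n → ℤ)) × (Matrix (Fin n) (Fin m) (ZMod q) × (Fin m → ℤ)) |
            IsSolution' cr.2.1 β cr.2.2} from hsol), mul_comm B']
        refine mul_le_mul_of_nonneg_left ?_ ENNReal.toReal_nonneg
        have hin : inner ((c, κ), (queryMatrixD B N S q c κ, z)) =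
            ∑' y, ((condLawD B N s (fun _ => 0) c) y).toReal *
              f (outputD B N S q (((c, κ), (queryMatrixD B N S q c κ, z)), y)) := by
          rw [hinner]
          refine tsum_congr fun y => ?_
          rw [if_pos ⟨hsol, mem_WLat_of_mem (outputD_mem hS q _)⟩]
        rw [hin]
        exact hcond c κ z hcr hsol
      · have hin : inner ((c, κ), (queryMatrixD B N S q c κ, z)) = 0 := by
          rw [hinner]
          simp only [hsol, false_and, if_false, mul_zero, tsum_zero]
        rw [hin, mul_zero]
        exact mul_nonneg hB' (Set.indicator_nonneg (fun _ _ => ENNReal.toReal_nonneg) _)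
    · rw [(PMF.apply_eq_zero_iff P₁ cr).2 hcr, ENNReal.toReal_zero, zero_mul]
      exact mul_nonneg hB' (Set.indicator_nonneg (fun _ _ => ENNReal.toReal_nonneg) _)
  have hs1 : Summable fun cr => (P₁ cr).toReal * inner cr := summable_toReal_mul_of_bounded P₁ hib
  have hs2 : Summable fun cr => B' * {cr | IsSolution' cr.2.1 β cr.2.2}.indicator (fun cr => (P₁ cr).toReal) cr :=
    ((summable_coe_toReal P₁).indicator _).mul_left B'
  refine (hs1.tsum_le_tsum hpt hs2).trans (le_of_eq ?_)
  rw [tsum_mul_left, toReal_toOuterMeasure_apply]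

/-- **Bounds for the conditional witness law `D`** (`Pr[wRunD = w] = Pr[¬abort]·D(w)`, `Pr[abort] ≠ 1`):
under the hypotheses of `tsum_wRunD_some_toReal_mul_le`, `E_D[f] ≤ B'`.
[cite: MicciancioRegev2007, Thm. 5.23 (proof, pp. 30–31)] -/
theorem tsum_condD_toReal_mul_le [IsZLattice ℝ (dualLat B)] (hB : B.det ≠ 0)
    (hS : ∀ j, intVecToEuclidean n (S j) ∈ dualLat B) {q : ℕ}
    (O : Matrix (Fin n) (Fin m) (ZMod q) → PMF (Fin m → ℤ)) (s β : ℝ) (ℓ : ℕ)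
    (hρ : (wRunD B N S hB O s β ℓ) none ≠ 1) {D : PMF (WLat B)}
    (hD : ∀ w, (wRunD B N S hB O s β ℓ) (some w) = (1 - (wRunD B N S hB O s β ℓ) none) * D w)
    (f : EuclideanSpace ℝ (Fin n) → ℝ) {M : ℝ} (hM : 0 ≤ M) (hf : ∀ v, |f v| ≤ M) {B' : ℝ} (hB' : 0 ≤ B')
    (hcond : ∀ (c : Fin m → Grp B N) (κ : Fin m → Fin n → ℤ) (z : Fin m → ℤ),
      ((c, κ), (queryMatrixD B N S q c κ, z)) ∈ (firstStageD B N S hB O s ℓ).support →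
      IsSolution' (queryMatrixD B N S q c κ) β z →
      ∑' y, ((condLawD B N s (fun _ => 0) c) y).toReal *
        f (outputD B N S q (((c, κ), (queryMatrixD B N S q c κ, z)), y)) ≤ B') :
    ∑' w, (D w).toReal * f (w : EuclideanSpace ℝ (Fin n)) ≤ B' := by
  rw [tsum_toReal_cond_eq hD hρ (fun w : WLat B => f (w : EuclideanSpace ℝ (Fin n)))]
  have hmain := tsum_wRunD_some_toReal_mul_le B N S hB hS O s β ℓ f hM hf hB' hcond
  rw [← one_sub_wRunD_none_toReal B N S hB hS] at hmain
  have hlt : ((wRunD B N S hB O s β ℓ) none).toReal < 1 := by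
    have h : (wRunD B N S hB O s β ℓ) none < 1 := lt_of_le_of_ne ((wRunD B N S hB O s β ℓ).coe_le_one _) hρ
    have := (ENNReal.toReal_lt_toReal (PMF.apply_ne_top _ _) ENNReal.one_ne_top).2 h
    rwa [ENNReal.toReal_one] at this
  have hpos : 0 < 1 - ((wRunD B N S hB O s β ℓ) none).toReal := by linarith
  calc (1 - ((wRunD B N S hB O s β ℓ) none).toReal)⁻¹ *
        ∑' w, ((wRunD B N S hB O s β ℓ) (some w)).toReal * f (w : EuclideanSpace ℝ (Fin n))
      ≤ (1 - ((wRunD B N S hB O s β ℓ) none).toReal)⁻¹ * (B' * (1 - ((wRunD B N S hB O s β ℓ) none).toReal)) :=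
        mul_le_mul_of_nonneg_left hmain (inv_nonneg.2 hpos.le)
    _ = B' := by field_simp

/-! ### Transfer in `ℝ≥0∞` (unbounded nonnegative functions: eq. (18), second moments) -/

/-- **Per-condition bounds transfer to the success part of `wRunD`, in `ℝ≥0∞`.**
[cite: MicciancioRegev2007, Thm. 5.23 (proof, pp. 30–31)] -/
theorem tsum_wRunD_some_mul_le [IsZLattice ℝ (dualLat B)] (hB : B.det ≠ 0)
    (hS : ∀ j, intVecToEuclidean n (S j) ∈ dualLat B) {q : ℕ}
    (O : Matrix (Fin n) (Fin m) (ZMod q) → PMF (Fin m → ℤ)) (s β : ℝ) (ℓ : ℕ)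
    (g : EuclideanSpace ℝ (Fin n) → ℝ≥0∞) {B' : ℝ≥0∞}
    (hcond : ∀ (c : Fin m → Grp B N) (κ : Fin m → Fin n → ℤ) (z : Fin m → ℤ),
      ((c, κ), (queryMatrixD B N S q c κ, z)) ∈ (firstStageD B N S hB O s ℓ).support →
      IsSolution' (queryMatrixD B N S q c κ) β z →
      ∑' y, (condLawD B N s (fun _ => 0) c) y * g (outputD B N S q (((c, κ), (queryMatrixD B N S q c κ, z)), y)) ≤ B') :
    ∑' w, (wRunD B N S hB O s β ℓ) (some w) * g (w : EuclideanSpace ℝ (Fin n)) ≤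
      B' * (firstStageD B N S hB O s ℓ).toOuterMeasure {cr | IsSolution' cr.2.1 β cr.2.2} := by
  set P₁ := firstStageD B N S hB O s ℓ with hP₁
  have hmap : ∀ {Ω γ : Type _} (E : PMF Ω) (F : Ω → γ) (G : γ → ℝ≥0∞),
      ∑' o, (E.map F) o * G o = ∑' ω, E ω * G (F ω) := by
    intro Ω γ E F G
    simp_rw [PMF.map_apply, ← ENNReal.tsum_mul_right]
    rw [ENNReal.tsum_comm]
    refine tsum_congr fun ω => ?_
    rw [tsum_eq_single (F ω)]
    · rw [if_pos rfl]
    · intro o ho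
      rw [if_neg ho, zero_mul]
  have hbind : ∀ {Ω γ : Type _} (p : PMF γ) (K : γ → PMF Ω) (H : Ω → ℝ≥0∞),
      ∑' ω, (p.bind K) ω * H ω = ∑' c, p c * ∑' ω, K c ω * H ω := by
    intro Ω γ p K H
    simp_rw [PMF.bind_apply, ← ENNReal.tsum_mul_right, mul_assoc]
    rw [ENNReal.tsum_comm]
    exact tsum_congr fun c => ENNReal.tsum_mul_left
  have h1 : ∑' w, (wRunD B N S hB O s β ℓ) (some w) * g (w : EuclideanSpace ℝ (Fin n)) =
      ∑' o, (wRunD B N S hB O s β ℓ) o * o.elim 0 (fun w : WLat B => g (w : EuclideanSpace ℝ (Fin n))) :=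
    tsum_some_eq_tsum (fun o => (wRunD B N S hB O s β ℓ) o * o.elim 0 (fun w : WLat B => g (w : EuclideanSpace ℝ (Fin n))))
      (by simp)
  rw [h1, wRunD, hmap, experimentD_zero_eq_pairing B N S hB O s ℓ, hbind, ← hP₁, PMF.toOuterMeasure_apply,
    ← ENNReal.tsum_mul_left]
  refine ENNReal.tsum_le_tsum fun cr => ?_
  rw [hmap]
  by_cases hcr : cr ∈ P₁.support
  · obtain ⟨⟨c, κ⟩, ⟨A, z⟩⟩ := cr
    have hA : A = queryMatrixD B N S q c κ := queryD_eq_of_mem_support_firstStageD B N S hB O s ℓ hcr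
    subst hA
    by_cases hsol : IsSolution' (queryMatrixD B N S q c κ) β z
    · rw [Set.indicator_of_mem (show ((c, κ), (queryMatrixD B N S q c κ, z)) ∈
        {cr : ((Fin m → Grp B N) × (Fin m → Fin n → ℤ)) × (Matrix (Fin n) (Fin m) (ZMod q) × (Fin m → ℤ)) |
          IsSolution' cr.2.1 β cr.2.2} from hsol), mul_comm B']
      refine mul_le_mul' le_rfl ?_
      refine le_of_eq_of_le (tsum_congr fun y => ?_) (hcond c κ z hcr hsol)
      rw [dif_pos ⟨hsol, mem_WLat_of_mem (outputD_mem hS q _)⟩]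
      rfl
    · refine le_of_eq_of_le ?_ zero_le
      rw [ENNReal.tsum_eq_zero.2 fun y => ?_, mul_zero]
      rw [dif_neg (fun h => hsol h.1)]
      exact mul_zero _
  · rw [(PMF.apply_eq_zero_iff P₁ _).2 hcr, zero_mul]
    exact zero_le

/-- **Eq. (18)-type bounds for the conditional witness law `D`, in `ℝ≥0∞`**: `∑_w D(w) g(w) ≤ B'`.
[cite: MicciancioRegev2007, Thm. 5.23 (proof, pp. 30–31)] -/
theorem tsum_condD_mul_le [IsZLattice ℝ (dualLat B)] (hB : B.det ≠ 0)
    (hS : ∀ j, intVecToEuclidean n (S j) ∈ dualLat B) {q : ℕ}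
    (O : Matrix (Fin n) (Fin m) (ZMod q) → PMF (Fin m → ℤ)) (s β : ℝ) (ℓ : ℕ)
    (hρ : (wRunD B N S hB O s β ℓ) none ≠ 1) {D : PMF (WLat B)}
    (hD : ∀ w, (wRunD B N S hB O s β ℓ) (some w) = (1 - (wRunD B N S hB O s β ℓ) none) * D w)
    (g : EuclideanSpace ℝ (Fin n) → ℝ≥0∞) {B' : ℝ≥0∞}
    (hcond : ∀ (c : Fin m → Grp B N) (κ : Fin m → Fin n → ℤ) (z : Fin m → ℤ),
      ((c, κ), (queryMatrixD B N S q c κ, z)) ∈ (firstStageD B N S hB O s ℓ).support →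
      IsSolution' (queryMatrixD B N S q c κ) β z →
      ∑' y, (condLawD B N s (fun _ => 0) c) y * g (outputD B N S q (((c, κ), (queryMatrixD B N S q c κ, z)), y)) ≤ B') :
    ∑' w, D w * g (w : EuclideanSpace ℝ (Fin n)) ≤ B' := by
  have hmain := tsum_wRunD_some_mul_le B N S hB hS O s β ℓ g hcond
  rw [← one_sub_wRunD_none B N S hB hS] at hmain
  have heq : ∑' w, (wRunD B N S hB O s β ℓ) (some w) * g (w : EuclideanSpace ℝ (Fin n)) =
      (1 - (wRunD B N S hB O s β ℓ) none) * ∑' w, D w * g (w : EuclideanSpace ℝ (Fin n)) := by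
    simp_rw [hD, mul_assoc]
    exact ENNReal.tsum_mul_left
  rw [heq, mul_comm B'] at hmain
  have h0 : 1 - (wRunD B N S hB O s β ℓ) none ≠ 0 :=
    (tsub_pos_iff_lt.2 (lt_of_le_of_ne ((wRunD B N S hB O s β ℓ).coe_le_one _) hρ)).ne'
  have htop : 1 - (wRunD B N S hB O s β ℓ) none ≠ ∞ := ne_top_of_le_ne_top ENNReal.one_ne_top tsub_le_self
  exact (ENNReal.mul_le_mul_iff_right h0 htop).1 hmain

end DualGrid

end Literature.Algebra.EuclideanLattices

end
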